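import Summits.BirchSwinnertonDyer.Rank1Residual.Additive.GordTwistMinimalModel
import Summits.BirchSwinnertonDyer.Rank1Residual.Additive.GordIsogenyInvarianceClasses
import Literature.NumberTheory.EllipticCurves.SemistabilityDefectAtThreeTameWitnessProofs
import Literature.NumberTheory.EllipticCurves.ModularJacobianNeronDifferentialsTameProofs
import Literature.NumberTheory.DiophantineGeometry.MinimalModelUniquenessProofs
import HarnessLib

/-!
# Route `TeichmullerTwistDescent` (and `TameQuarticManinParity`): the Néron-differential JUMP of a tame potentially
# good curve, typed as `HasTameGoodModel p e W a` — a Tate profile at an odd prime `p` gives a good model over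
# `ℚ(ϖ)`, `ϖ^e = −p`, with exponent `a`, `12a = e·ord_p Δ_min`; Kodaira III ↦ `a/e = 1/4`, III* ↦ `a/e = 3/4`
# (`--supports` PSMU, stmt-BirchSwinnertonDyer-22638; route-independent module)

Cell `pub/bsd-wall`, D-0145 line `route-BirchSwinnertonDyer-TeichmullerTwistDescent`, seat `bsd-line-ttd-p1` g15.
BSD is NOT proved by this; Manin's conjecture is not proved by this; no route item is closed by this. THEOREMS ONLY
(no definition, no named fact, no `sorry`); the module imports NO route file (theses-cone clean), so both Manin routes
at `3` (TQMP, carrier `TameNeronFormsAt N 3 8`) and at `p ≥ 5` (TTD: the thesis's «Gauss-sum valuation = Néron jump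
`a/e`», memo MECHANISM-K-lattice §4 item K4) can import it.

## What is proved

* §2 `isTameIntegral_ratCast_mul_inv_tameUnif_pow`: `x·ϖ^{−n} ∈ O_K` when `n ≤ e·k`, `ord_p x ≥ k`.
* §3 `rigidity_of_profile`: *AEC* VII.1.3(b) at the place `(p)` — `W` globally minimal, `C • W` `p`-integral with the
  same `ord_p Δ` ⇒ `ord_p u = 0`, `r, s, t ∈ ℤ_(p)` (tree lemmas `valuation_le_one_of_pow_four_eq` / `_sq_eq`).
* §4 **`hasTameGoodModel_of_tateProfile`**: odd prime `p`, `e ≥ 1`, `W/ℚ` globally minimal, `C` ℚ-rational with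
  `ord_p aᵢ(C • W) ≥ kᵢ`, `ord_p Δ(C • W) = ord_p Δ_min(W) = d`, and `i·a ≤ e·kᵢ`, `12a = e·d` ⇒ `HasTameGoodModel p e W a`
  (the model `(ϖ^a, r, s, t) • W_ℂ` has coefficients `u₀ⁱ aᵢ ϖ^{−ia} ∈ O_K` and `Δ' = ±u₀¹²Δ₁/p^d`, a unit).
* The Kodaira III / III* instances (Néron jumps `1/4`, `3/4`; TQMP's S41/S41* at `(p, e) = (3, 8)`, the carrier
  `TameNeronFormsAt N p 4` on TTD's III rows at `e = 4`) are in the sequel `TeichmullerTwistDescentKodairaIIITameGoodModel`.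

References: [SilvermanATAEC1994] IV.9.4 Steps 4 and 9, Table 4.1; [SilvermanAEC2009] III Table 3.1, VII.1 Prop. 1.3
(b), (d), Remark 1.1; [EdixhovenManin1991] Prop. 4 and §4 (the exponents `a/n`); [SerreLocalFields1979] I §6 Prop. 17–18.
-/

set_option autoImplicit false
-- D-0017: single-problem summit, so `Summit.BirchSwinnertonDyer.BirchSwinnertonDyer.…` repeats a namespace BY DESIGN.
set_option linter.dupNamespace false

noncomputable section

open scoped Classical

open WeierstrassCurve IsDedekindDomain IsDedekindDomain.HeightOneSpectrum Rat.HeightOneSpectrum WithZero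
  Literature.NumberTheory.EllipticCurves Literature.NumberTheory.EllipticCurves.ModularForms
  Literature.NumberTheory.DiophantineGeometry Summit.BirchSwinnertonDyer.Rank1Residual.Additive

namespace Summit.BirchSwinnertonDyer.BirchSwinnertonDyer.Theorems.TeichmullerTwistDescent.TameGoodModel

variable (p : ℕ) [hp : Fact p.Prime]

/-! ### §1 Valuation bookkeeping at the place `(p)` of `ℚ` -/

/-- `|x|_{(p)} = exp(−ord_p x)` for `x ≠ 0`. [folklore] -/
theorem valuation_placeOf_eq {x : ℚ} (hx : x ≠ 0) :
    (placeOf p).valuation ℚ x = exp (-padicValRat p x) := by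
  rw [Rat.HeightOneSpectrum.valuation_eq_exp_neg_padicValRat (placeOf p) hx, natGenerator_placeOf_eq p]

/-- `|x|_{(p)} ≤ exp(−k)` with `x ≠ 0` gives `k ≤ ord_p x`. [folklore] -/
theorem le_padicValRat_of_valuation_le {x : ℚ} (hx : x ≠ 0) {k : ℤ}
    (h : (placeOf p).valuation ℚ x ≤ exp (-k)) : k ≤ padicValRat p x := by
  rw [valuation_placeOf_eq p hx, exp_le_exp] at h
  omega

/-- `|x|_{(p)} ≤ 1` gives `0 ≤ ord_p x` (also for `x = 0`). [folklore] -/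
theorem padicValRat_nonneg_of_valuation_le_one {x : ℚ} (h : (placeOf p).valuation ℚ x ≤ 1) :
    0 ≤ padicValRat p x := by
  rcases eq_or_ne x 0 with rfl | hx
  · simp
  · exact le_padicValRat_of_valuation_le p hx (k := 0) (by simpa using h)

/-- `|x|_{(p)} = 1` with `x ≠ 0` gives `ord_p x = 0`. [folklore] -/
theorem padicValRat_eq_zero_of_valuation_eq_one {x : ℚ} (hx : x ≠ 0)
    (h : (placeOf p).valuation ℚ x = 1) : padicValRat p x = 0 := by
  rw [valuation_placeOf_eq p hx, ← exp_zero, exp_inj] at h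
  omega

/-- Integers have `|n|_{(p)} ≤ 1`. [folklore] -/
theorem valuation_intCast_le_one (n : ℤ) : (placeOf p).valuation ℚ (n : ℚ) ≤ 1 := by
  rw [← eq_intCast (algebraMap ℤ ℚ) n]
  exact valuation_le_one _ _

/-! ### §2 Negative powers of the tame uniformiser against `p`-divisible rationals -/

/-- **`x·ϖ^{−n} ∈ O_K`** for `x ∈ ℚ` with `ord_p x ≥ k` and `n ≤ e·k`: `ϖ^{−n} = ϖ^{ek−n}·(ϖ^e)^{−k} = ϖ^{ek−n}·(−p)^{−k}`,
and `x·(−p)^{−k} ∈ ℤ_(p)`. [cite: SerreLocalFields1979, Ch. I §6, Prop. 17–18] -/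
theorem isTameIntegral_ratCast_mul_inv_tameUnif_pow {e : ℕ} (he : 0 < e) {x : ℚ} {n k : ℕ} (hn : n ≤ e * k)
    (hx : x ≠ 0 → (k : ℤ) ≤ padicValRat p x) :
    IsTameIntegral p e ((x : ℂ) * (tameUnif p e ^ n)⁻¹) := by
  have hpP : p.Prime := hp.out
  set ϖ := tameUnif p e with hϖdef
  have hϖ : ϖ ≠ 0 := tameUnif_ne_zero e hpP.ne_zero
  have hE : ϖ ^ e = -p := tameUnif_pow he.ne'
  have hp0 : ((-p : ℚ)) ≠ 0 := neg_ne_zero.mpr (Nat.cast_ne_zero.mpr hpP.ne_zero)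
  -- `ϖ^{−n} = ϖ^{ek−n} · ((−p)^k)⁻¹`
  have key : (ϖ ^ n)⁻¹ = ϖ ^ (e * k - n) * ((((-p : ℚ)) ^ k : ℚ) : ℂ)⁻¹ := by
    have h1 : ϖ ^ (e * k) = ((((-p : ℚ)) ^ k : ℚ) : ℂ) := by
      rw [pow_mul, hE]; push_cast; ring
    have h2 : ϖ ^ n * (ϖ ^ (e * k - n) * ((((-p : ℚ)) ^ k : ℚ) : ℂ)⁻¹) = 1 := by
      rw [← mul_assoc, ← pow_add, Nat.add_sub_cancel' hn, h1, mul_inv_cancel₀]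
      exact_mod_cast pow_ne_zero k hp0
    exact inv_eq_of_mul_eq_one_right h2
  rw [key, show (x : ℂ) * (ϖ ^ (e * k - n) * ((((-p : ℚ)) ^ k : ℚ) : ℂ)⁻¹) =
    (((x * (((-p : ℚ)) ^ k)⁻¹ : ℚ)) : ℂ) * ϖ ^ (e * k - n) by push_cast; ring]
  refine isTameIntegral_ratCast_mul_tameUnif_pow hpP he ?_ _
  rcases eq_or_ne x 0 with rfl | hx0
  · simp
  · rw [padicValRat.mul hx0 (inv_ne_zero (pow_ne_zero k hp0)), padicValRat.inv, padicValRat.pow,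
      padicValRat.neg, show (p : ℚ) = ((p : ℕ) : ℚ) by rfl, padicValRat.self hpP.one_lt]
    have := hx hx0
    linarith

/-! ### §3 Rigidity (Silverman AEC VII.1.3 (b)) at the place `(p)` -/

/-- **Rigidity of a `p`-integral change of variables out of a globally minimal equation.** If `W/ℚ` is globally
minimal, `C • W` has `p`-integral coefficients and `ord_p Δ(C • W) = ord_p Δ_min(W)`, then `u` is a `p`-unit and
`r, s, t ∈ ℤ_(p)`: the `b₆`/`b₈` transformation formulas make `r` a root of a monic quartic with `p`-integral
coefficients, then `s` and `t` satisfy monic quadratics (Silverman's argument, via the tree's valuation lemmas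
`valuation_le_one_of_pow_four_eq`, `valuation_le_one_of_sq_eq`). [cite: SilvermanAEC2009, VII.1 Prop. 1.3 (b), (d)] -/
theorem rigidity_of_profile (W : WeierstrassCurve ℚ) [W.IsElliptic] [W.IsGloballyMinimal] (C : VariableChange ℚ)
    (i₁a₁ : (placeOf p).valuation ℚ (C • W).a₁ ≤ 1) (i₁a₂ : (placeOf p).valuation ℚ (C • W).a₂ ≤ 1)
    (i₁a₃ : (placeOf p).valuation ℚ (C • W).a₃ ≤ 1) (i₁a₄ : (placeOf p).valuation ℚ (C • W).a₄ ≤ 1)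
    (i₁a₆ : (placeOf p).valuation ℚ (C • W).a₆ ≤ 1)
    (cΔ : (placeOf p).valuation ℚ (C • W).Δ = (placeOf p).valuation ℚ W.Δ) :
    (placeOf p).valuation ℚ (C.u : ℚ) = 1 ∧ (placeOf p).valuation ℚ C.r ≤ 1 ∧
      (placeOf p).valuation ℚ C.s ≤ 1 ∧ (placeOf p).valuation ℚ C.t ≤ 1 := by
  set v := placeOf p with hvdef
  set W₁ := C • W with hW₁
  -- `u₀` is a `p`-unit
  have hΔ0 : v.valuation ℚ W.Δ ≠ 0 := (Valuation.ne_zero_iff _).mpr W.Δ'.ne_zero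
  have hu : v.valuation ℚ (C.u : ℚ) = 1 := by
    have hui0 : v.valuation ℚ (↑C.u⁻¹ : ℚ) ≠ 0 := (Valuation.ne_zero_iff _).mpr (C.u⁻¹).ne_zero
    have h12 : v.valuation ℚ (↑C.u⁻¹ : ℚ) ^ 12 = 1 := by
      have h := cΔ
      rw [hW₁, variableChange_Δ, map_mul, map_pow] at h
      calc v.valuation ℚ (↑C.u⁻¹ : ℚ) ^ 12
          = v.valuation ℚ (↑C.u⁻¹ : ℚ) ^ 12 * v.valuation ℚ W.Δ * (v.valuation ℚ W.Δ)⁻¹ := by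
            rw [mul_assoc, mul_inv_cancel₀ hΔ0, mul_one]
        _ = 1 := by rw [h, mul_inv_cancel₀ hΔ0]
    have hlog : v.valuation ℚ (↑C.u⁻¹ : ℚ) = exp (log (v.valuation ℚ (↑C.u⁻¹ : ℚ))) := (exp_log hui0).symm
    have hone : v.valuation ℚ (↑C.u⁻¹ : ℚ) = 1 := by
      rw [hlog, ← exp_nsmul, ← exp_zero, exp_inj] at h12
      rw [hlog, ← exp_zero, exp_inj]
      simpa using h12
    have hprod : v.valuation ℚ (C.u : ℚ) * v.valuation ℚ (↑C.u⁻¹ : ℚ) = 1 := by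
      rw [← map_mul, C.u.mul_inv, map_one]
    rw [hone, mul_one] at hprod
    exact hprod
  -- integrality of `W` (globally minimal)
  have h3le : v.valuation ℚ (3 : ℚ) ≤ 1 := by
    have h := valuation_intCast_le_one p 3
    rw [hvdef]; exact_mod_cast h
  have hZ : (W.integralModelInt).map (Int.castRingHom ℚ) = W := map_integralModelInt W
  have iW : v.valuation ℚ W.a₁ ≤ 1 ∧ v.valuation ℚ W.a₂ ≤ 1 ∧ v.valuation ℚ W.a₃ ≤ 1 ∧
      v.valuation ℚ W.a₄ ≤ 1 ∧ v.valuation ℚ W.a₆ ≤ 1 ∧ v.valuation ℚ W.b₂ ≤ 1 ∧ v.valuation ℚ W.b₄ ≤ 1 ∧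
      v.valuation ℚ W.b₆ ≤ 1 ∧ v.valuation ℚ W.b₈ ≤ 1 := by
    refine ⟨?_, ?_, ?_, ?_, ?_, ?_, ?_, ?_, ?_⟩
    · rw [← hZ, map_a₁]; exact valuation_intCast_le_one p _
    · rw [← hZ, map_a₂]; exact valuation_intCast_le_one p _
    · rw [← hZ, map_a₃]; exact valuation_intCast_le_one p _
    · rw [← hZ, map_a₄]; exact valuation_intCast_le_one p _
    · rw [← hZ, map_a₆]; exact valuation_intCast_le_one p _
    · rw [← hZ, map_b₂]; exact valuation_intCast_le_one p _
    · rw [← hZ, map_b₄]; exact valuation_intCast_le_one p _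
    · rw [← hZ, map_b₆]; exact valuation_intCast_le_one p _
    · rw [← hZ, map_b₈]; exact valuation_intCast_le_one p _
  obtain ⟨iWa₁, iWa₂, iWa₃, iWa₄, iWa₆, iWb₂, iWb₄, iWb₆, iWb₈⟩ := iW
  have hI : ∀ {x : ℚ}, x ∈ (v.valuation ℚ).integer ↔ v.valuation ℚ x ≤ 1 := Valuation.mem_integer_iff _ _
  have m₁ := hI.2 i₁a₁
  have m₂ := hI.2 i₁a₂
  have m₃ := hI.2 i₁a₃
  have m₄ := hI.2 i₁a₄
  have m₆ := hI.2 i₁a₆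
  have i₁b₆ : v.valuation ℚ W₁.b₆ ≤ 1 := by
    refine hI.1 ?_
    simp only [WeierstrassCurve.b₆]
    exact add_mem (pow_mem m₃ 2) (mul_mem (ofNat_mem _ _) m₆)
  have i₁b₈ : v.valuation ℚ W₁.b₈ ≤ 1 := by
    refine hI.1 ?_
    simp only [WeierstrassCurve.b₈]
    exact sub_mem (add_mem (sub_mem (add_mem (mul_mem (pow_mem m₁ 2) m₆)
      (mul_mem (mul_mem (ofNat_mem _ _) m₂) m₆)) (mul_mem (mul_mem m₁ m₃) m₄)) (mul_mem m₂ (pow_mem m₃ 2)))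
      (pow_mem m₄ 2)
  -- `r`
  have hr : v.valuation ℚ C.r ≤ 1 := by
    have hA : v.valuation ℚ ((C.u : ℚ) ^ 6 * W₁.b₆ - W.b₆) ≤ 1 := by
      refine Valuation.map_sub_le _ ?_ iWb₆
      rw [map_mul, map_pow, hu, one_pow, one_mul]; exact i₁b₆
    have hB : v.valuation ℚ ((C.u : ℚ) ^ 8 * W₁.b₈ - W.b₈) ≤ 1 := by
      refine Valuation.map_sub_le _ ?_ iWb₈
      rw [map_mul, map_pow, hu, one_pow, one_mul]; exact i₁b₈
    have e₆ : (C.u : ℚ) ^ 6 * W₁.b₆ - W.b₆ = 2 * C.r * W.b₄ + C.r ^ 2 * W.b₂ + 4 * C.r ^ 3 := by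
      rw [hW₁, variableChange_b₆]
      linear_combination (W.b₆ + 2 * C.r * W.b₄ + C.r ^ 2 * W.b₂ + 4 * C.r ^ 3) *
        pow_mul_pow_eq_one 6 C.u.mul_inv
    have e₈ : (C.u : ℚ) ^ 8 * W₁.b₈ - W.b₈ =
        3 * C.r * W.b₆ + 3 * C.r ^ 2 * W.b₄ + C.r ^ 3 * W.b₂ + 3 * C.r ^ 4 := by
      rw [hW₁, variableChange_b₈]
      linear_combination (W.b₈ + 3 * C.r * W.b₆ + 3 * C.r ^ 2 * W.b₄ + C.r ^ 3 * W.b₂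
        + 3 * C.r ^ 4) * pow_mul_pow_eq_one 8 C.u.mul_inv
    refine valuation_le_one_of_pow_four_eq (v.valuation ℚ) (x := C.r)
      (p := W.b₄) (q := 3 * W.b₆ + ((C.u : ℚ) ^ 6 * W₁.b₆ - W.b₆))
      (c := -((C.u : ℚ) ^ 8 * W₁.b₈ - W.b₈)) iWb₄ ?_ ?_ ?_
    · refine Valuation.map_add_le _ ?_ hA
      rw [map_mul]
      exact mul_le_one' h3le iWb₆
    · rw [Valuation.map_neg]; exact hB
    · linear_combination e₈ - C.r * e₆
  -- `s`
  have hs : v.valuation ℚ C.s ≤ 1 := by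
    have e₂ : C.s ^ 2 = (-W.a₁) * C.s + (W.a₂ + 3 * C.r - (C.u : ℚ) ^ 2 * W₁.a₂) := by
      rw [hW₁, variableChange_a₂]
      linear_combination (W.a₂ - C.s * W.a₁ + 3 * C.r - C.s ^ 2) * pow_mul_pow_eq_one 2 C.u.mul_inv
    refine valuation_le_one_of_sq_eq (v.valuation ℚ) (by rwa [Valuation.map_neg]) ?_ e₂
    refine Valuation.map_sub_le _ (Valuation.map_add_le _ iWa₂ ?_) ?_
    · rw [map_mul]
      exact mul_le_one' h3le hr
    · rw [map_mul, map_pow, hu, one_pow, one_mul]; exact i₁a₂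
  -- `t`
  have htt : v.valuation ℚ C.t ≤ 1 := by
    have e₆ : C.t ^ 2 = (-(W.a₃ + C.r * W.a₁)) * C.t +
        (W.a₆ + C.r * W.a₄ + C.r ^ 2 * W.a₂ + C.r ^ 3 - (C.u : ℚ) ^ 6 * W₁.a₆) := by
      rw [hW₁, variableChange_a₆]
      linear_combination (W.a₆ + C.r * W.a₄ + C.r ^ 2 * W.a₂ + C.r ^ 3 - C.t * W.a₃
        - C.t ^ 2 - C.r * C.t * W.a₁) * pow_mul_pow_eq_one 6 C.u.mul_inv
    have hr2 : v.valuation ℚ (C.r ^ 2) ≤ 1 := by rw [map_pow]; exact pow_le_one' hr 2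
    have hr3 : v.valuation ℚ (C.r ^ 3) ≤ 1 := by rw [map_pow]; exact pow_le_one' hr 3
    refine valuation_le_one_of_sq_eq (v.valuation ℚ) ?_ ?_ e₆
    · rw [Valuation.map_neg]
      refine Valuation.map_add_le _ iWa₃ ?_
      rw [map_mul]; exact mul_le_one' hr iWa₁
    · refine Valuation.map_sub_le _ ?_ ?_
      · refine Valuation.map_add_le _ (Valuation.map_add_le _ (Valuation.map_add_le _ iWa₆ ?_) ?_) hr3
        · rw [map_mul]; exact mul_le_one' hr iWa₄
        · rw [map_mul]; exact mul_le_one' hr2 iWa₂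
      · rw [map_mul, map_pow, hu, one_pow, one_mul]; exact i₁a₆
  exact ⟨hu, hr, hs, htt⟩

/-! ### §4 The good model from a Tate profile -/

/-- **`HasTameGoodModel p e W a` from a Tate profile.** `p` an odd prime, `e ≥ 1`, `W/ℚ` globally minimal with
`ord_p Δ_min(W) = d`; `C` a ℚ-rational change of variables with `ord_p aᵢ(C • W) ≥ kᵢ` and `ord_p Δ(C • W) = d`;
`a` an exponent with `i·a ≤ e·kᵢ` (`i = 1, 2, 3, 4, 6`) and `12a = e·d`. Then `(ϖ^a, r, s, t) • W_ℂ`, `ϖ^e = −p`,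
has coefficients `u₀ⁱ·aᵢ(C • W)·ϖ^{−ia} ∈ O_K` and discriminant `u₀¹²·Δ(C • W)·(−p)^{−d}`, a unit of `ℤ_(p)` — where
`(u₀, r, s, t) = C` has `u₀ ∈ ℤ_(p)ˣ`, `r, s, t ∈ ℤ_(p)` by §3. [cite: SilvermanAEC2009, VII.1 Prop. 1.3 (b), (d) and Remark 1.1]
[cite: SilvermanATAEC1994, IV.9.4 (Tate's algorithm) and Table 4.1] -/
theorem hasTameGoodModel_of_tateProfile {e : ℕ} (he : 0 < e) (W : WeierstrassCurve ℚ) [W.IsElliptic]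
    [W.IsGloballyMinimal] (C : VariableChange ℚ) {k₁ k₂ k₃ k₄ k₆ d a : ℕ}
    (c₁ : (placeOf p).valuation ℚ (C • W).a₁ ≤ exp (-(k₁ : ℤ)))
    (c₂ : (placeOf p).valuation ℚ (C • W).a₂ ≤ exp (-(k₂ : ℤ)))
    (c₃ : (placeOf p).valuation ℚ (C • W).a₃ ≤ exp (-(k₃ : ℤ)))
    (c₄ : (placeOf p).valuation ℚ (C • W).a₄ ≤ exp (-(k₄ : ℤ)))
    (c₆ : (placeOf p).valuation ℚ (C • W).a₆ ≤ exp (-(k₆ : ℤ)))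
    (cΔ : (placeOf p).valuation ℚ (C • W).Δ = exp (-(d : ℤ)))
    (hd : padicValInt p W.minimalDiscriminantInt = d)
    (h₁ : a ≤ e * k₁) (h₂ : 2 * a ≤ e * k₂) (h₃ : 3 * a ≤ e * k₃) (h₄ : 4 * a ≤ e * k₄) (h₆ : 6 * a ≤ e * k₆)
    (h₁₂ : 12 * a = e * d) : HasTameGoodModel p e W a := by
  have hpP : p.Prime := hp.out
  set v := placeOf p with hvdef
  set W₁ := C • W with hW₁
  have hΔW : v.valuation ℚ W.Δ = exp (-(d : ℤ)) := by
    rw [hvdef, valuation_placeOf_Δ_eq p W, hd]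
  have hle1 : ∀ {x : ℚ} {k : ℕ}, v.valuation ℚ x ≤ exp (-(k : ℤ)) → v.valuation ℚ x ≤ 1 :=
    fun {x k} h ↦ h.trans (by rw [← exp_zero, exp_le_exp]; omega)
  obtain ⟨hu, hr, hs, htt⟩ := rigidity_of_profile p W C (hle1 c₁) (hle1 c₂) (hle1 c₃) (hle1 c₄) (hle1 c₆)
    (by rw [cΔ, hΔW])
  -- `p`-adic data in `padicValRat` currency
  have hu0 : (C.u : ℚ) ≠ 0 := C.u.ne_zero
  have vu : padicValRat p (C.u : ℚ) = 0 := padicValRat_eq_zero_of_valuation_eq_one p hu0 hu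
  have vr : 0 ≤ padicValRat p C.r := padicValRat_nonneg_of_valuation_le_one p hr
  have vs : 0 ≤ padicValRat p C.s := padicValRat_nonneg_of_valuation_le_one p hs
  have vt : 0 ≤ padicValRat p C.t := padicValRat_nonneg_of_valuation_le_one p htt
  have hΔ₁0 : W₁.Δ ≠ 0 := by
    intro h0; rw [h0, map_zero] at cΔ; exact exp_ne_zero cΔ.symm
  have vΔ : padicValRat p W₁.Δ = d := by
    have h := cΔ
    rw [valuation_placeOf_eq p hΔ₁0, exp_inj] at h
    omega
  -- valuation of `u₀^i · x`
  have hux : ∀ (i : ℕ) {x : ℚ} {k : ℕ}, v.valuation ℚ x ≤ exp (-(k : ℤ)) →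
      ((C.u : ℚ) ^ i * x ≠ 0 → (k : ℤ) ≤ padicValRat p ((C.u : ℚ) ^ i * x)) := by
    intro i x k hx hne
    have hx0 : x ≠ 0 := by rintro rfl; exact hne (mul_zero _)
    rw [padicValRat.mul (pow_ne_zero i hu0) hx0, padicValRat.pow, vu, mul_zero, zero_add]
    exact le_padicValRat_of_valuation_le p hx0 hx
  -- the coefficients of the normal form, multiplied back by `u₀^i`
  have P₁ : W.a₁ + 2 * C.s = (C.u : ℚ) * W₁.a₁ := by
    rw [hW₁, variableChange_a₁]
    linear_combination (-(W.a₁ + 2 * C.s)) * C.u.mul_inv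
  have P₂ : W.a₂ - C.s * W.a₁ + 3 * C.r - C.s ^ 2 = (C.u : ℚ) ^ 2 * W₁.a₂ := by
    rw [hW₁, variableChange_a₂]
    linear_combination (-(W.a₂ - C.s * W.a₁ + 3 * C.r - C.s ^ 2)) * pow_mul_pow_eq_one 2 C.u.mul_inv
  have P₃ : W.a₃ + C.r * W.a₁ + 2 * C.t = (C.u : ℚ) ^ 3 * W₁.a₃ := by
    rw [hW₁, variableChange_a₃]
    linear_combination (-(W.a₃ + C.r * W.a₁ + 2 * C.t)) * pow_mul_pow_eq_one 3 C.u.mul_inv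
  have P₄ : W.a₄ - C.s * W.a₃ + 2 * C.r * W.a₂ - (C.t + C.r * C.s) * W.a₁ + 3 * C.r ^ 2 - 2 * C.s * C.t =
      (C.u : ℚ) ^ 4 * W₁.a₄ := by
    rw [hW₁, variableChange_a₄]
    linear_combination (-(W.a₄ - C.s * W.a₃ + 2 * C.r * W.a₂ - (C.t + C.r * C.s) * W.a₁ + 3 * C.r ^ 2
      - 2 * C.s * C.t)) * pow_mul_pow_eq_one 4 C.u.mul_inv
  have P₆ : W.a₆ + C.r * W.a₄ + C.r ^ 2 * W.a₂ + C.r ^ 3 - C.t * W.a₃ - C.t ^ 2 - C.r * C.t * W.a₁ =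
      (C.u : ℚ) ^ 6 * W₁.a₆ := by
    rw [hW₁, variableChange_a₆]
    linear_combination (-(W.a₆ + C.r * W.a₄ + C.r ^ 2 * W.a₂ + C.r ^ 3 - C.t * W.a₃ - C.t ^ 2
      - C.r * C.t * W.a₁)) * pow_mul_pow_eq_one 6 C.u.mul_inv
  have PΔ : W.Δ = (C.u : ℚ) ^ 12 * W₁.Δ := by
    rw [hW₁, variableChange_Δ]
    linear_combination (-W.Δ) * pow_mul_pow_eq_one 12 C.u.mul_inv
  -- the complex model `(ϖ^a, r, s, t) • W_ℂ`
  set ϖ := tameUnif p e with hϖdef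
  have hϖ : ϖ ≠ 0 := tameUnif_ne_zero e hpP.ne_zero
  have hE : ϖ ^ e = -p := tameUnif_pow he.ne'
  set T : VariableChange ℂ := ⟨Units.mk0 (ϖ ^ a) (pow_ne_zero a hϖ), (C.r : ℂ), (C.s : ℂ), (C.t : ℂ)⟩ with hT
  have hTu : ∀ i : ℕ, ((T.u⁻¹ : ℂˣ) : ℂ) ^ i = (ϖ ^ (a * i))⁻¹ := by
    intro i; rw [Units.val_inv_eq_inv_val, hT, Units.val_mk0, inv_pow, ← pow_mul]
  have hTu1 : ((T.u⁻¹ : ℂˣ) : ℂ) = (ϖ ^ (a * 1))⁻¹ := by rw [← hTu 1, pow_one]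
  have hbc₁ : (W.baseChange ℂ).a₁ = (W.a₁ : ℂ) := by simp [WeierstrassCurve.baseChange, WeierstrassCurve.map]
  have hbc₂ : (W.baseChange ℂ).a₂ = (W.a₂ : ℂ) := by simp [WeierstrassCurve.baseChange, WeierstrassCurve.map]
  have hbc₃ : (W.baseChange ℂ).a₃ = (W.a₃ : ℂ) := by simp [WeierstrassCurve.baseChange, WeierstrassCurve.map]
  have hbc₄ : (W.baseChange ℂ).a₄ = (W.a₄ : ℂ) := by simp [WeierstrassCurve.baseChange, WeierstrassCurve.map]
  have hbc₆ : (W.baseChange ℂ).a₆ = (W.a₆ : ℂ) := by simp [WeierstrassCurve.baseChange, WeierstrassCurve.map]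
  have hbcΔ : (W.baseChange ℂ).Δ = (W.Δ : ℂ) := by
    simp [WeierstrassCurve.baseChange, WeierstrassCurve.map_Δ]
  have hT₁ : (T • W.baseChange ℂ).a₁ = ((((C.u : ℚ) ^ 1 * W₁.a₁ : ℚ)) : ℂ) * (ϖ ^ (a * 1))⁻¹ := by
    rw [variableChange_a₁, hTu1, hbc₁]
    have h : ((W.a₁ : ℚ) : ℂ) + 2 * (C.s : ℂ) = (((C.u : ℚ) * W₁.a₁ : ℚ) : ℂ) := by exact_mod_cast P₁
    simp only [hT]
    rw [h]; push_cast; ring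
  have hT₂ : (T • W.baseChange ℂ).a₂ = ((((C.u : ℚ) ^ 2 * W₁.a₂ : ℚ)) : ℂ) * (ϖ ^ (a * 2))⁻¹ := by
    rw [variableChange_a₂, hTu 2, hbc₁, hbc₂]
    have h : ((W.a₂ : ℚ) : ℂ) - (C.s : ℂ) * (W.a₁ : ℂ) + 3 * (C.r : ℂ) - (C.s : ℂ) ^ 2 =
        (((C.u : ℚ) ^ 2 * W₁.a₂ : ℚ) : ℂ) := by exact_mod_cast P₂
    simp only [hT]
    rw [h]; push_cast; ring
  have hT₃ : (T • W.baseChange ℂ).a₃ = ((((C.u : ℚ) ^ 3 * W₁.a₃ : ℚ)) : ℂ) * (ϖ ^ (a * 3))⁻¹ := by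
    rw [variableChange_a₃, hTu 3, hbc₁, hbc₃]
    have h : ((W.a₃ : ℚ) : ℂ) + (C.r : ℂ) * (W.a₁ : ℂ) + 2 * (C.t : ℂ) =
        (((C.u : ℚ) ^ 3 * W₁.a₃ : ℚ) : ℂ) := by exact_mod_cast P₃
    simp only [hT]
    rw [h]; push_cast; ring
  have hT₄ : (T • W.baseChange ℂ).a₄ = ((((C.u : ℚ) ^ 4 * W₁.a₄ : ℚ)) : ℂ) * (ϖ ^ (a * 4))⁻¹ := by
    rw [variableChange_a₄, hTu 4, hbc₁, hbc₂, hbc₃, hbc₄]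
    have h : ((W.a₄ : ℚ) : ℂ) - (C.s : ℂ) * (W.a₃ : ℂ) + 2 * (C.r : ℂ) * (W.a₂ : ℂ)
        - ((C.t : ℂ) + (C.r : ℂ) * (C.s : ℂ)) * (W.a₁ : ℂ) + 3 * (C.r : ℂ) ^ 2 - 2 * (C.s : ℂ) * (C.t : ℂ) =
        (((C.u : ℚ) ^ 4 * W₁.a₄ : ℚ) : ℂ) := by exact_mod_cast P₄
    simp only [hT]
    rw [h]; push_cast; ring
  have hT₆ : (T • W.baseChange ℂ).a₆ = ((((C.u : ℚ) ^ 6 * W₁.a₆ : ℚ)) : ℂ) * (ϖ ^ (a * 6))⁻¹ := by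
    rw [variableChange_a₆, hTu 6, hbc₁, hbc₂, hbc₃, hbc₄, hbc₆]
    have h : ((W.a₆ : ℚ) : ℂ) + (C.r : ℂ) * (W.a₄ : ℂ) + (C.r : ℂ) ^ 2 * (W.a₂ : ℂ) + (C.r : ℂ) ^ 3
        - (C.t : ℂ) * (W.a₃ : ℂ) - (C.t : ℂ) ^ 2 - (C.r : ℂ) * (C.t : ℂ) * (W.a₁ : ℂ) =
        (((C.u : ℚ) ^ 6 * W₁.a₆ : ℚ) : ℂ) := by exact_mod_cast P₆
    simp only [hT]
    rw [h]; push_cast; ring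
  -- the discriminant: `ϖ^{−12a} = (ϖ^e)^{−d} = (−p)^{−d}`
  have hp0 : ((-p : ℚ)) ≠ 0 := neg_ne_zero.mpr (Nat.cast_ne_zero.mpr hpP.ne_zero)
  set Y : ℚ := (C.u : ℚ) ^ 12 * W₁.Δ * (((-p : ℚ)) ^ d)⁻¹ with hY
  have hY0 : Y ≠ 0 := mul_ne_zero (mul_ne_zero (pow_ne_zero 12 hu0) hΔ₁0) (inv_ne_zero (pow_ne_zero d hp0))
  have hTΔ : (T • W.baseChange ℂ).Δ = ((Y : ℚ) : ℂ) := by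
    rw [variableChange_Δ, hTu 12, hbcΔ, PΔ, show a * 12 = e * d by omega, pow_mul, hE, hY]
    push_cast; ring
  -- assemble
  refine ⟨hϖ, (C.r : ℂ), (C.s : ℂ), (C.t : ℂ),
    IsPIntegral.isTameIntegral he ⟨C.r, vr, rfl⟩,
    IsPIntegral.isTameIntegral he ⟨C.s, vs, rfl⟩,
    IsPIntegral.isTameIntegral he ⟨C.t, vt, rfl⟩, ?_⟩
  show IsTameIntegral p e (T • W.baseChange ℂ).a₁ ∧ IsTameIntegral p e (T • W.baseChange ℂ).a₂ ∧
    IsTameIntegral p e (T • W.baseChange ℂ).a₃ ∧ IsTameIntegral p e (T • W.baseChange ℂ).a₄ ∧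
    IsTameIntegral p e (T • W.baseChange ℂ).a₆ ∧
    ∃ y : ℂ, IsTameIntegral p e y ∧ (T • W.baseChange ℂ).Δ * y = 1
  rw [hT₁, hT₂, hT₃, hT₄, hT₆, hTΔ]
  refine ⟨isTameIntegral_ratCast_mul_inv_tameUnif_pow p he (by omega) (hux 1 c₁),
    isTameIntegral_ratCast_mul_inv_tameUnif_pow p he (by omega) (hux 2 c₂),
    isTameIntegral_ratCast_mul_inv_tameUnif_pow p he (by omega) (hux 3 c₃),
    isTameIntegral_ratCast_mul_inv_tameUnif_pow p he (by omega) (hux 4 c₄),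
    isTameIntegral_ratCast_mul_inv_tameUnif_pow p he (by omega) (hux 6 c₆),
    ((Y⁻¹ : ℚ) : ℂ), ?_, ?_⟩
  · refine IsPIntegral.isTameIntegral he ⟨Y⁻¹, ?_, rfl⟩
    rw [padicValRat.inv, hY, padicValRat.mul (mul_ne_zero (pow_ne_zero 12 hu0) hΔ₁0) (inv_ne_zero (pow_ne_zero d hp0)),
      padicValRat.mul (pow_ne_zero 12 hu0) hΔ₁0, padicValRat.inv, padicValRat.pow, padicValRat.pow, vu, vΔ,
      padicValRat.neg, show (p : ℚ) = ((p : ℕ) : ℚ) by rfl, padicValRat.self hpP.one_lt]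
    simp
  · have hne : ((Y : ℚ) : ℂ) ≠ 0 := by exact_mod_cast hY0
    have h : ((Y * Y⁻¹ : ℚ) : ℂ) = 1 := by rw [mul_inv_cancel₀ hY0]; push_cast; rfl
    simpa [Rat.cast_mul, Rat.cast_inv] using h

end Summit.BirchSwinnertonDyer.BirchSwinnertonDyer.Theorems.TeichmullerTwistDescent.TameGoodModel

end
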